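import Summits.RiemannHypothesis.RiemannHypothesis.Theorems.IntegerScrewScrewPolyFloorLandauBilinear
import Literature.NumberTheory.LFunctions.LandauGonekFormulaSharp
import HarnessLib

/-!
# Route IntegerScrew — Landau's formula at the ratios `m/m'`, sharp form

Helper file for crux `IntegerScrew.ScrewPolyFloor` (stmt-RiemannHypothesis-15757): the entrywise
input of the sharp window lower bound (`IntegerScrewScrewPolyFloorLandauBlockSharp.lean`). For
`1 ≤ m' < m ≤ M`, `T ≥ 2`, `x = m/m'`, Landau's formula with the sharp resonance term
(`LandauGonek.landau_gonek_formula_sharp`) gives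

  `‖L(x;T) + (T/π)Λ(x)‖ ≤ C ((10x² + 8m²/(m−m')²) log²T + x² log 3M + M log 3M)`

(`landauSum_ratio_bound_sharp`): `(1 + 1/log x)² ≤ 2 + 2/log²x`, `x²/log²x ≤ 4x² + 4m²/(m−m')²`
(`sq_div_log_sq_le`), `log 3x ≤ log 3M`, and the resonance `x/⟨x⟩ ≤ x·m' = m ≤ M`
(`inv_le_primePowDist_div`) — in the crude `landauSum_ratio_bound` every entry cost `8 C M⁴ log²T`.
-/

noncomputable section

open Complex Finset
open scoped Real ComplexConjugate

-- the layout-mandated namespace repeats the summit name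
set_option linter.dupNamespace false

namespace Summit.RiemannHypothesis.RiemannHypothesis.Theorems.IntegerScrewLandau

open Literature.NumberTheory.LFunctions ArithmeticFunction

/-! ### Landau's formula at the ratios, sharp form -/

/-- **Landau's formula at the ratios, sharp form.** With `C` the constant of
`landau_gonek_formula_sharp`: for `1 ≤ m' < m ≤ M`, `T ≥ 2`, `x = m/m'`,
`‖L(x; T) + (T/π) Λ(x)‖ ≤ C ((10 x² + 8 m²/(m−m')²) log²T + x² log 3M + M log 3M)`
(`(1 + 1/log x)² ≤ 2 + 2/log²x`, `x²/log²x ≤ 4x² + 4m²/(m−m')²` (`sq_div_log_sq_le`), `x ≤ M`,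
`x/⟨x⟩ ≤ x m' = m ≤ M` (`inv_le_primePowDist_div`)). [folklore] -/
theorem landauSum_ratio_bound_sharp :
    ∀ {C : ℝ}, 0 < C →
    (∀ x : ℝ, 1 < x → ∀ T : ℝ, 2 ≤ T →
      ‖∑ ρ ∈ (weilZeroIndex_finite T).toFinset, (riemannZetaZeroOrder ρ : ℂ) * (x : ℂ) ^ ρ +
          (((T / π * (if ((⌊x⌋₊ : ℕ) : ℝ) = x then Λ ⌊x⌋₊ else 0)) : ℝ) : ℂ)‖ ≤
        C * (x ^ 2 * ((1 + 1 / Real.log x) ^ 2 * Real.log T ^ 2 + Real.log (3 * x)) +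
          Real.log (3 * x) * min T (x / primePowDist x))) →
    ∀ {M m m' : ℕ}, 1 ≤ m' → m' < m → m ≤ M → ∀ {T : ℝ}, 2 ≤ T →
    ‖∑ ρ ∈ (weilZeroIndex_finite T).toFinset,
          (riemannZetaZeroOrder ρ : ℂ) * ((((m : ℝ) / m' : ℝ)) : ℂ) ^ ρ +
        (((T / π * (if ((⌊(m : ℝ) / m'⌋₊ : ℕ) : ℝ) = (m : ℝ) / m' then Λ ⌊(m : ℝ) / m'⌋₊ else 0)) : ℝ) : ℂ)‖ ≤
      C * ((10 * ((m : ℝ) / m') ^ 2 + 8 * ((m : ℝ) ^ 2 / ((m : ℝ) - m') ^ 2)) * Real.log T ^ 2 +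
        ((m : ℝ) / m') ^ 2 * Real.log (3 * M) + M * Real.log (3 * M)) := by
  intro C hC0 hC M m m' hm' hlt hmM T hT
  set x : ℝ := (m : ℝ) / m' with hx
  have hm'0 : (0 : ℝ) < m' := by exact_mod_cast hm'
  have hmm' : (m' : ℝ) < m := by exact_mod_cast hlt
  have hm0 : (0 : ℝ) < m := by linarith
  have hx1 : 1 < x := by rw [hx, one_lt_div hm'0]; exact hmm'
  have hx0 : 0 < x := by linarith
  have hmM' : (m : ℝ) ≤ M := by exact_mod_cast hmM
  have hM1 : (1 : ℝ) ≤ M := by exact_mod_cast le_trans hm' (hlt.le.trans hmM)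
  have hM0 : (0 : ℝ) < M := by linarith
  have hxM : x ≤ M := by
    rw [hx, div_le_iff₀ hm'0]
    calc (m : ℝ) ≤ M := hmM'
      _ = M * 1 := (mul_one _).symm
      _ ≤ M * m' := by gcongr; exact_mod_cast hm'
  set L : ℝ := Real.log x with hL
  have hL0 : 0 < L := Real.log_pos hx1
  set lam : ℝ := Real.log (3 * M) with hlam
  have hlam3x : Real.log (3 * x) ≤ lam := Real.log_le_log (by positivity) (by linarith)
  have hlam0 : 0 ≤ Real.log (3 * x) := Real.log_nonneg (by linarith)
  have hlam0' : 0 ≤ lam := hlam0.trans hlam3x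
  -- the resonance: `x/⟨x⟩ ≤ m ≤ M`
  have hpd : x / primePowDist x ≤ M := by
    have h1 := inv_le_primePowDist_div (m := m) hm'
    have hpos : (0 : ℝ) < 1 / m' := by positivity
    calc x / primePowDist x ≤ x / (1 / m') := div_le_div_of_nonneg_left hx0.le hpos h1
      _ = x * m' := by rw [div_div_eq_mul_div, div_one]
      _ = m := by rw [hx]; field_simp
      _ ≤ M := hmM'
  have hT0 : 0 < T := by linarith
  have hmin : min T (x / primePowDist x) ≤ M := (min_le_right _ _).trans hpd
  have hmin0 : 0 ≤ min T (x / primePowDist x) :=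
    le_min hT0.le (by have := primePowDist_pos x; positivity)
  -- `(1 + 1/L)² ≤ 2 + 2/L²` and `x²/L² ≤ 4x² + 4m²/(m−m')²`
  have hfac : (1 + 1 / L) ^ 2 ≤ 2 + 2 * (1 / L) ^ 2 := by nlinarith [sq_nonneg (1 - 1 / L)]
  have hsq : x ^ 2 / L ^ 2 ≤ 4 * x ^ 2 + 4 * ((m : ℝ) ^ 2 / ((m : ℝ) - m') ^ 2) := by
    rw [hx, hL]; exact sq_div_log_sq_le hm' hlt
  have hlT0 : 0 ≤ Real.log T ^ 2 := sq_nonneg _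
  have hsub0 : 0 < (m : ℝ) - m' := by linarith
  have hK0 : 0 ≤ (m : ℝ) ^ 2 / ((m : ℝ) - m') ^ 2 := by positivity
  refine (hC x hx1 T hT).trans ?_
  rw [← hL]
  have h1 : x ^ 2 * ((1 + 1 / L) ^ 2 * Real.log T ^ 2) ≤
      (10 * x ^ 2 + 8 * ((m : ℝ) ^ 2 / ((m : ℝ) - m') ^ 2)) * Real.log T ^ 2 := by
    have e : x ^ 2 * ((1 + 1 / L) ^ 2 * Real.log T ^ 2) = (x ^ 2 * (1 + 1 / L) ^ 2) * Real.log T ^ 2 := by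
      ring
    rw [e]
    refine mul_le_mul_of_nonneg_right ?_ hlT0
    have h2 : x ^ 2 * (1 / L) ^ 2 = x ^ 2 / L ^ 2 := by rw [one_div_pow]; ring
    calc x ^ 2 * (1 + 1 / L) ^ 2 ≤ x ^ 2 * (2 + 2 * (1 / L) ^ 2) :=
          mul_le_mul_of_nonneg_left hfac (sq_nonneg _)
      _ = 2 * x ^ 2 + 2 * (x ^ 2 / L ^ 2) := by rw [← h2]; ring
      _ ≤ 2 * x ^ 2 + 2 * (4 * x ^ 2 + 4 * ((m : ℝ) ^ 2 / ((m : ℝ) - m') ^ 2)) := by linarith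
      _ = 10 * x ^ 2 + 8 * ((m : ℝ) ^ 2 / ((m : ℝ) - m') ^ 2) := by ring
  have h2 : x ^ 2 * Real.log (3 * x) ≤ x ^ 2 * lam := mul_le_mul_of_nonneg_left hlam3x (sq_nonneg _)
  have h3 : Real.log (3 * x) * min T (x / primePowDist x) ≤ M * lam := by
    calc Real.log (3 * x) * min T (x / primePowDist x) ≤ lam * M :=
          mul_le_mul hlam3x hmin hmin0 hlam0'
      _ = M * lam := mul_comm _ _
  have key : x ^ 2 * ((1 + 1 / L) ^ 2 * Real.log T ^ 2 + Real.log (3 * x)) +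
      Real.log (3 * x) * min T (x / primePowDist x) ≤
      (10 * x ^ 2 + 8 * ((m : ℝ) ^ 2 / ((m : ℝ) - m') ^ 2)) * Real.log T ^ 2 + x ^ 2 * lam + M * lam := by
    rw [mul_add]
    linarith
  exact mul_le_mul_of_nonneg_left key hC0.le

end Summit.RiemannHypothesis.RiemannHypothesis.Theorems.IntegerScrewLandau

end
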